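import Summits.BirchSwinnertonDyer.Rank1Residual.AdditivePotMult.QuadraticTwistTamagawaTypeIVFlip
import Summits.BirchSwinnertonDyer.Rank1Residual.AdditivePotMult.QuadraticTwistTamagawaMultiplicative
import Literature.NumberTheory.EllipticCurves.GlobalMinimalModelProofs
import Literature.NumberTheory.EllipticCurves.QuadraticTwistPadicReduction
import HarnessLib

/-!
# The type-`IV` / `IV*` FLIP at a PLACE: from `kodairaSymbolAt v W = IV` to
# `v₃(c_v(W)) + v₃(c_v(W^{(d)})) = 1` for a non-square unit `d`, and `c_v(W^{(d)}) = c_v(W)` for a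
# square unit (row T-MIL-B, file B-2e; seat n1011-p08 GEN 3)

HONEST FRAMING (cell `b2b-bsdres`, run/shared/lean/b2b/bsd-rank1-residual/, verbatim in every
file): the goal of the cell is to DELETE the COMBINATION-SHAPED residual classes of the
Birch–Swinnerton-Dyer formula for ALL analytic-rank `≤ 1` elliptic curves over `ℚ` — "full BSD
formula for every rank `≤ 1` curve in class `C`" assembled STRICTLY from published theorems — so
that the rank-`≤ 1` remainder becomes exactly the CONSTRUCTION-SHAPED classes, which are TYPED
(missing-input `Prop`s), NOT attempted. This is not "finishing BSD". Sub-classes X3♯(M) / X4(M)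
(additive, base-change-and-descend): a RESEARCH ROUTE; they stay CONSTRUCTION-SHAPED; nothing is
booked by this file; no mark / label moved; no consumer binder (`hWR`, `hodd`, A65/A73) changes
before T-MIL-ODD stage C. THEOREMS ONLY: no definition, no named fact, no `sorry`. OUT OF THIS
ROW (said in every file): the wild sub-case `ℓ = 3 = p ∣ d_K` and `ℓ = 2`.

## What (skeleton `cells/n1011/skel/T-MIL-B.md` §1 (B2)(ii) and (B3), place-level wrappers)

* §1 `isMinimal_smul_baseChange` — an `R`-change of variables of a minimal equation is minimal
  (Silverman *AEC* VII.1 Prop. 1.3 (b)); this DISCHARGES the minimality binder of the B-1/B-2 files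
  for normal forms obtained from the chosen local minimal model (referee-1 proviso (i) / lit F4).
* §2 `exists_normalForm_IV_of_kodairaSymbolAt_eq_IV` (and `…IVstar…`) — at a finite place `v` of a
  Dedekind domain with PERFECT residue field, if Tate's algorithm returns `IV` (`IV*`) then `W ⊗ K_v`
  has a MINIMAL `𝒪_v`-model in type-`IV` (`IV*`) normal form with a separable residual quadratic
  (tree `exists_smul_of_kodairaSymbolOfMinimal_eq_IV[star]` on the integral minimal model, §1).
* §3 over `ℚ`, at a place `v` above an ODD prime `ℓ ∤ d`:
  - `localTamagawaNumber_quadraticTwist_eq_of_isSquare` — `(d/ℓ) = +1 ⇒ c_v(W^{(d)}) = c_v(W)` for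
    ANY `W/ℚ` (the SPLIT line of (B3));
  - **`padicValNat_localTamagawaNumber_add_quadraticTwist_eq_one_of_kodairaSymbolAt_eq_IV`**
    (and `…IVstar`) — `(d/ℓ) = −1` and `W` of type `IV` (`IV*`) at `v` ⇒
    **`v₃(c_v(W)) + v₃(c_v(W^{(d)})) = 1`** — the twist side of the INERT line of (L_ℓ)@3.
  Here `c_v(X) = (X ⊗ ℚ_v).localTamagawaNumber 𝒪_v` and `W^{(d)} = W.quadraticTwist d` (tree model).

References: Silverman *ATAEC* IV.9.4 Steps 5, 8; *AEC* VII.1 Prop. 1.3, X.5 Cor. 5.4. The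
base-change side at places (unramified `c_w`, ramified `e = 2`) is NOT in this file (abstract form in
`QuadraticBaseChangeTamagawaTypeIVUnramified`; the `𝒪_v → 𝒪_w` instantiation is stage C's).
-/

noncomputable section

open scoped Classical NumberField

open WeierstrassCurve IsLocalRing IsDedekindDomain NumberField Rat.HeightOneSpectrum
  Literature.NumberTheory.EllipticCurves Literature.NumberTheory.EllipticCurves.LocalIndex
  Literature.NumberTheory.DiophantineGeometry.TateAlgorithm

namespace Summit.BirchSwinnertonDyer.Rank1Residual.AdditivePotMult

namespace TypeIVTwist

/-! ## §1 `R`-changes of variables preserve minimality -/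

section DVR

variable {R : Type*} [CommRing R] [IsDomain R] [IsDiscreteValuationRing R]
  {K : Type*} [Field K] [Algebra R K] [IsFractionRing R K]

/-- **An `R`-integral change of variables of a minimal equation is minimal** (Silverman, *AEC*
VII.1 Prop. 1.3 (b)): `D ∈ VariableChange R` keeps integrality (tree `IsIntegral.smul_baseChange`)
and the valuation of `Δ` (tree `valuation_Δ_smul_baseChange`), so Mathlib's `IsMinimal` (a
`MaximalFor` over all further changes of variables) transports.
[cite: SilvermanAEC2009, VII.1 Prop. 1.3(b)] -/
theorem isMinimal_smul_baseChange (X : WeierstrassCurve K) [hX : X.IsMinimal R]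
    (D : VariableChange R) : (D.baseChange K • X).IsMinimal R := by
  have hmax := hX.val_Δ_maximal
  haveI hint : (D.baseChange K • X).IsIntegral R := IsIntegral.smul_baseChange X D
  have hval : valuation_Δ_aux R (D.baseChange K • X) = valuation_Δ_aux R X := by
    apply Subtype.ext
    rw [valuation_Δ_aux_eq_of_isIntegral R (D.baseChange K • X), valuation_Δ_aux_eq_of_isIntegral R X,
      valuation_Δ_smul_baseChange]
  refine ⟨⟨by simpa using hint, ?_⟩⟩
  intro C hC hle
  simp only [smul_smul, one_mul] at hC hle ⊢
  rw [hval] at hle ⊢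
  have h2 := hmax.2 hC
  simp only [one_smul] at h2
  exact h2 hle

end DVR

/-! ## §2 From `kodairaSymbolAt v W = IV / IV*` to a minimal normal form -/

section NormalFormAtPlace

variable {A : Type*} [CommRing A] [IsDedekindDomain A] {K : Type*} [Field K] [Algebra A K]
  [IsFractionRing A K] (v : HeightOneSpectrum A) (W : WeierstrassCurve K)

/-- The separability of the residual quadratic from `b₆ ∉ 𝔪³` (type `IV`: `a₃ = ϖγ`, `a₆ = ϖ²ε`
give `b₆ = ϖ²(γ² + 4ε)`) — over any discrete valuation ring (private helper). [folklore] -/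
private theorem disc_ne_zero_of_b₆_IV {R : Type*} [CommRing R] [IsDomain R]
    [IsDiscreteValuationRing R] (J : WeierstrassCurve R) {ϖ γ ε : R} (hϖ : Irreducible ϖ)
    (hγ : J.a₃ = ϖ * γ) (hε : J.a₆ = ϖ ^ 2 * ε) (hb₆ : J.b₆ ∉ maximalIdeal R ^ 3) :
    residue R γ ^ 2 + 4 * residue R ε ≠ 0 := by
  intro h0
  apply hb₆
  have hdvd : ϖ ∣ γ ^ 2 + 4 * ε := by
    rw [dvd_iff_residue_eq_zero hϖ]
    simpa only [map_add, map_pow, map_mul, map_ofNat] using h0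
  obtain ⟨c, hc⟩ := hdvd
  rw [hϖ.maximalIdeal_eq, Ideal.span_singleton_pow, Ideal.mem_span_singleton]
  exact ⟨c, by rw [WeierstrassCurve.b₆, hγ, hε]; linear_combination ϖ ^ 2 * hc⟩

/-- Same for type `IV*` (`a₃ = ϖ²γ`, `a₆ = ϖ⁴ε`, `b₆ = ϖ⁴(γ² + 4ε) ∉ 𝔪⁵`) — here read from the
tree's `distinctRootCount (quadraticStep8 J) = 2` (private helper). [folklore] -/
private theorem disc_ne_zero_of_step8_IVstar {R : Type*} [CommRing R] [IsDomain R]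
    [IsDiscreteValuationRing R] (J : WeierstrassCurve R) {γ ε : R}
    (hγ : J.a₃ = uniformizer R ^ 2 * γ) (hε : J.a₆ = uniformizer R ^ 4 * ε)
    (h8 : distinctRootCount (quadraticStep8 J) = 2) :
    residue R γ ^ 2 + 4 * residue R ε ≠ 0 := by
  rw [quadraticStep8_eq hγ hε] at h8
  unfold distinctRootCount at h8
  exact (card_aroots_toFinset_sq_add_sub_eq_two_iff_ne_zero
    (L := AlgebraicClosure (ResidueField R)) (residue R γ) (residue R ε)).mp (by convert h8)

/-- **A minimal type-`IV` normal form at a place of type `IV`.** If Tate's algorithm at `v` returns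
`IV` (perfect residue field), then `W ⊗ K_v` has an `𝒪_v`-model `J` with `D • (W ⊗ K_v) = J ⊗ K_v`,
`J ⊗ K_v` MINIMAL, in the type-`IV` normal form w.r.t. the chosen uniformiser `ϖ = uniformizer 𝒪_v`
(`a₁, a₂ ∈ 𝔪`, `a₃ = ϖγ`, `a₄ ∈ 𝔪²`, `a₆ = ϖ²ε`) with separable residual quadratic
(`γ̄² + 4ε̄ ≠ 0`). [cite: SilvermanATAEC1994, IV.9.4 Step 5 (PDF p. 344)] [cite: SilvermanAEC2009, VII.1 Prop. 1.3(b)] -/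
theorem exists_normalForm_IV_of_kodairaSymbolAt_eq_IV [W.IsElliptic]
    [PerfectField (ResidueField (v.adicCompletionIntegers K))] (hIV : W.kodairaSymbolAt v = .IV) :
    ∃ (J : WeierstrassCurve (v.adicCompletionIntegers K)) (D : VariableChange (v.adicCompletion K))
      (γ ε : v.adicCompletionIntegers K),
      D • W.baseChange (v.adicCompletion K) = J.baseChange (v.adicCompletion K) ∧
      (J.baseChange (v.adicCompletion K)).IsMinimal (v.adicCompletionIntegers K) ∧
      J.a₁ ∈ maximalIdeal _ ∧ J.a₂ ∈ maximalIdeal _ ∧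
      J.a₃ = uniformizer (v.adicCompletionIntegers K) * γ ∧ J.a₄ ∈ maximalIdeal _ ^ 2 ∧
      J.a₆ = uniformizer (v.adicCompletionIntegers K) ^ 2 * ε ∧
      residue _ γ ^ 2 + 4 * residue _ ε ≠ 0 := by
  set R := v.adicCompletionIntegers K with hR
  set Kv := v.adicCompletion K with hKv
  have hk := hIV
  rw [WeierstrassCurve.kodairaSymbolAt_def] at hk
  have hϖ : Irreducible (uniformizer R) := irreducible_uniformizer
  -- work with an integral presentation `M = I ⊗ K_v` of the chosen local minimal model
  have key : ∀ (M : WeierstrassCurve Kv) [M.IsMinimal R],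
      (M.integralModel R).kodairaSymbolOfMinimal = .IV →
      (∃ D₀ : VariableChange Kv, M = D₀ • W.baseChange Kv) →
      ∃ (J : WeierstrassCurve R) (D : VariableChange Kv) (γ ε : R),
        D • W.baseChange Kv = J.baseChange Kv ∧ (J.baseChange Kv).IsMinimal R ∧
        J.a₁ ∈ maximalIdeal R ∧ J.a₂ ∈ maximalIdeal R ∧ J.a₃ = uniformizer R * γ ∧
        J.a₄ ∈ maximalIdeal R ^ 2 ∧ J.a₆ = uniformizer R ^ 2 * ε ∧
        residue R γ ^ 2 + 4 * residue R ε ≠ 0 := by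
    intro M hMmin hM hD₀
    obtain ⟨D₀, hD₀⟩ := hD₀
    obtain ⟨I, hI⟩ : ∃ I : WeierstrassCurve R, M = I.baseChange Kv := WeierstrassCurve.IsIntegral.integral
    subst hI
    rw [WeierstrassCurve.integralModel_baseChange_eq] at hM
    obtain ⟨D, h1, h2, h3, h4, h6, hb₆⟩ := exists_smul_of_kodairaSymbolOfMinimal_eq_IV I hM
    obtain ⟨γ, hγ⟩ := mem_maximalIdeal_iff_dvd.mp h3
    obtain ⟨ε, hε⟩ := mem_maximalIdeal_pow_iff_dvd.mp h6
    refine ⟨D • I, D.baseChange Kv * D₀, γ, ε, ?_, ?_, h1, h2, hγ, h4, hε,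
      disc_ne_zero_of_b₆_IV (D • I) hϖ hγ hε hb₆⟩
    · rw [mul_smul, ← hD₀, ← LocalIndex.baseChange_smul_eq I D]; rfl
    · rw [← LocalIndex.baseChange_smul_eq I D]
      exact isMinimal_smul_baseChange (I.baseChange Kv) D
  exact key (W.localMinimalModel v) hk ⟨_, rfl⟩

/-- **A minimal type-`IV*` normal form at a place of type `IV*`** (`a₁ ∈ 𝔪`, `a₂ ∈ 𝔪²`,
`a₃ = ϖ²γ`, `a₄ ∈ 𝔪³`, `a₆ = ϖ⁴ε`, `γ̄² + 4ε̄ ≠ 0`).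
[cite: SilvermanATAEC1994, IV.9.4 Step 8 (PDF p. 346)] [cite: SilvermanAEC2009, VII.1 Prop. 1.3(b)] -/
theorem exists_normalForm_IVstar_of_kodairaSymbolAt_eq_IVstar [W.IsElliptic]
    [PerfectField (ResidueField (v.adicCompletionIntegers K))]
    (hIV : W.kodairaSymbolAt v = .IVstar) :
    ∃ (J : WeierstrassCurve (v.adicCompletionIntegers K)) (D : VariableChange (v.adicCompletion K))
      (γ ε : v.adicCompletionIntegers K),
      D • W.baseChange (v.adicCompletion K) = J.baseChange (v.adicCompletion K) ∧
      (J.baseChange (v.adicCompletion K)).IsMinimal (v.adicCompletionIntegers K) ∧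
      J.a₁ ∈ maximalIdeal _ ∧ J.a₂ ∈ maximalIdeal _ ^ 2 ∧
      J.a₃ = uniformizer (v.adicCompletionIntegers K) ^ 2 * γ ∧ J.a₄ ∈ maximalIdeal _ ^ 3 ∧
      J.a₆ = uniformizer (v.adicCompletionIntegers K) ^ 4 * ε ∧
      residue _ γ ^ 2 + 4 * residue _ ε ≠ 0 := by
  set R := v.adicCompletionIntegers K with hR
  set Kv := v.adicCompletion K with hKv
  have hk := hIV
  rw [WeierstrassCurve.kodairaSymbolAt_def] at hk
  have key : ∀ (M : WeierstrassCurve Kv) [M.IsMinimal R],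
      (M.integralModel R).kodairaSymbolOfMinimal = .IVstar →
      (∃ D₀ : VariableChange Kv, M = D₀ • W.baseChange Kv) →
      ∃ (J : WeierstrassCurve R) (D : VariableChange Kv) (γ ε : R),
        D • W.baseChange Kv = J.baseChange Kv ∧ (J.baseChange Kv).IsMinimal R ∧
        J.a₁ ∈ maximalIdeal R ∧ J.a₂ ∈ maximalIdeal R ^ 2 ∧ J.a₃ = uniformizer R ^ 2 * γ ∧
        J.a₄ ∈ maximalIdeal R ^ 3 ∧ J.a₆ = uniformizer R ^ 4 * ε ∧
        residue R γ ^ 2 + 4 * residue R ε ≠ 0 := by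
    intro M hMmin hM hD₀
    obtain ⟨D₀, hD₀⟩ := hD₀
    obtain ⟨I, hI⟩ : ∃ I : WeierstrassCurve R, M = I.baseChange Kv := WeierstrassCurve.IsIntegral.integral
    subst hI
    rw [WeierstrassCurve.integralModel_baseChange_eq] at hM
    obtain ⟨D, h1, h2, h3, h4, h6, h8⟩ := exists_smul_of_kodairaSymbolOfMinimal_eq_IVstar I hM
    obtain ⟨γ, hγ⟩ := mem_maximalIdeal_pow_iff_dvd.mp h3
    obtain ⟨ε, hε⟩ := mem_maximalIdeal_pow_iff_dvd.mp h6
    refine ⟨D • I, D.baseChange Kv * D₀, γ, ε, ?_, ?_, h1, h2, hγ, h4, hε,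
      disc_ne_zero_of_step8_IVstar (D • I) hγ hε h8⟩
    · rw [mul_smul, ← hD₀, ← LocalIndex.baseChange_smul_eq I D]; rfl
    · rw [← LocalIndex.baseChange_smul_eq I D]
      exact isMinimal_smul_baseChange (I.baseChange Kv) D
  exact key (W.localMinimalModel v) hk ⟨_, rfl⟩

end NormalFormAtPlace

/-! ## §3 Over `ℚ`: the twist lines of (L_ℓ)@3 at a place of type `IV` / `IV*` -/

section RatPlace

variable (W : WeierstrassCurve ℚ) [W.IsElliptic] (v : HeightOneSpectrum (𝓞 ℚ))

omit [W.IsElliptic] in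
/-- The twist of the base change is the base change of the twist, with `d` read as the unit
`d' ∈ 𝒪_vˣ` (`ℓ ∤ d`) (private helper, as in A-2a). [folklore] -/
private theorem baseChange_quadraticTwist_eq {d : ℤ} (d' : (v.adicCompletionIntegers ℚ)ˣ)
    (hd' : (d' : v.adicCompletionIntegers ℚ) = d) :
    (W.quadraticTwist (d : ℚ)).baseChange (v.adicCompletion ℚ) =
      (W.baseChange (v.adicCompletion ℚ)).quadraticTwist
        (algebraMap (v.adicCompletionIntegers ℚ) (v.adicCompletion ℚ) d') := by
  have hcoe : algebraMap (v.adicCompletionIntegers ℚ) (v.adicCompletion ℚ)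
      (d' : v.adicCompletionIntegers ℚ) = ((d : ℤ) : v.adicCompletion ℚ) := by
    rw [hd', map_intCast]
  rw [baseChange, map_quadraticTwist, baseChange, map_intCast, hcoe]

/-- **`(d/ℓ) = +1 ⇒ c_v(W^{(d)}) = c_v(W)`** for ANY `W/ℚ` at a place `v` over an odd prime `ℓ ∤ d`
(`d` is a square in `𝒪_v` by Hensel; the SPLIT line of (B3)).
[cite: SilvermanAEC2009, X.5 Cor. 5.4 and VII.6 Ex. 7.6] -/
theorem localTamagawaNumber_quadraticTwist_eq_of_isSquare (hv2 : (primesEquiv v : ℕ) ≠ 2)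
    {d : ℤ} (hd : ¬ ((primesEquiv v : ℕ) : ℤ) ∣ d)
    (hsq : IsSquare ((d : ℤ) : ZMod (primesEquiv v : ℕ))) :
    ((W.quadraticTwist (d : ℚ)).baseChange (v.adicCompletion ℚ)).localTamagawaNumber
        (v.adicCompletionIntegers ℚ) =
      (W.baseChange (v.adicCompletion ℚ)).localTamagawaNumber (v.adicCompletionIntegers ℚ) := by
  haveI : (W.baseChange (v.adicCompletion ℚ)).IsElliptic := by rw [baseChange]; infer_instance
  obtain ⟨d', hd'⟩ : ∃ d' : (v.adicCompletionIntegers ℚ)ˣ, (d' : v.adicCompletionIntegers ℚ) = d :=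
    ⟨(isUnit_adicCompletionIntegers_intCast v hd).unit, IsUnit.unit_spec _⟩
  rw [baseChange_quadraticTwist_eq W v d' hd']
  refine localTamagawaNumber_quadraticTwist_eq_of_isSquare_residue
    (isUnit_two_adicCompletionIntegers v hv2) _ d' ?_
  rw [hd', isSquare_residue_intCast_iff]
  exact hsq

/-- **The type-`IV` FLIP at a place of `ℚ`: `v₃(c_v(W)) + v₃(c_v(W^{(d)})) = 1`** for `W/ℚ` with
`kodairaSymbolAt v W = IV`, `v` over an odd prime `ℓ ∤ d` with `(d/ℓ) = −1` — the twist side of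
the INERT line of (L_ℓ)@3 at a type-`IV` place (skeleton (B3): with the base-change side `c_w = 3`
the line reads `1 = 1 + 0`). Proof: §2 normal form + B-2b flip over the Henselian ring `𝒪_v`
(finite residue field `𝔽_ℓ`, `2 ∈ 𝒪_vˣ`). [cite: SilvermanATAEC1994, IV.9.4 Step 5 (PDF p. 344)] [cite: SilvermanAEC2009, X.5 Cor. 5.4] -/
theorem padicValNat_localTamagawaNumber_add_quadraticTwist_eq_one_of_kodairaSymbolAt_eq_IV
    (hv2 : (primesEquiv v : ℕ) ≠ 2) {d : ℤ} (hd : ¬ ((primesEquiv v : ℕ) : ℤ) ∣ d)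
    (hns : ¬ IsSquare ((d : ℤ) : ZMod (primesEquiv v : ℕ))) (hIV : W.kodairaSymbolAt v = .IV) :
    padicValNat 3 ((W.baseChange (v.adicCompletion ℚ)).localTamagawaNumber
        (v.adicCompletionIntegers ℚ)) +
      padicValNat 3 (((W.quadraticTwist (d : ℚ)).baseChange (v.adicCompletion ℚ)).localTamagawaNumber
        (v.adicCompletionIntegers ℚ)) = 1 := by
  haveI : (W.baseChange (v.adicCompletion ℚ)).IsElliptic := by rw [baseChange]; infer_instance
  haveI : Finite (ResidueField (v.adicCompletionIntegers ℚ)) :=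
    finite_residueField_adicCompletionIntegers_rat v
  haveI : PerfectField (ResidueField (v.adicCompletionIntegers ℚ)) := PerfectField.ofFinite
  obtain ⟨d', hd'⟩ : ∃ d' : (v.adicCompletionIntegers ℚ)ˣ, (d' : v.adicCompletionIntegers ℚ) = d :=
    ⟨(isUnit_adicCompletionIntegers_intCast v hd).unit, IsUnit.unit_spec _⟩
  have hns' : ¬ IsSquare (residue (v.adicCompletionIntegers ℚ) (d' : v.adicCompletionIntegers ℚ)) := by
    rw [hd', isSquare_residue_intCast_iff]; exact hns
  obtain ⟨J, D, γ, ε, hJ, hmin, h1, h2, hγ, h4, hε, hdisc⟩ :=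
    exists_normalForm_IV_of_kodairaSymbolAt_eq_IV v W hIV
  haveI := hmin
  rw [baseChange_quadraticTwist_eq W v d' hd']
  exact padicValNat_localTamagawaNumber_add_quadraticTwist_of_normalForm_IV
    (isUnit_two_adicCompletionIntegers v hv2) (W.baseChange (v.adicCompletion ℚ)) J D hJ h1 h2
    irreducible_uniformizer hγ h4 hε hdisc d' hns'

/-- **The type-`IV*` FLIP at a place of `ℚ`: `v₃(c_v(W)) + v₃(c_v(W^{(d)})) = 1`** (`(d/ℓ) = −1`,
`kodairaSymbolAt v W = IV*`, `ℓ ∤ 2d`). [cite: SilvermanATAEC1994, IV.9.4 Step 8 (PDF p. 346)] [cite: SilvermanAEC2009, X.5 Cor. 5.4] -/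
theorem padicValNat_localTamagawaNumber_add_quadraticTwist_eq_one_of_kodairaSymbolAt_eq_IVstar
    (hv2 : (primesEquiv v : ℕ) ≠ 2) {d : ℤ} (hd : ¬ ((primesEquiv v : ℕ) : ℤ) ∣ d)
    (hns : ¬ IsSquare ((d : ℤ) : ZMod (primesEquiv v : ℕ))) (hIV : W.kodairaSymbolAt v = .IVstar) :
    padicValNat 3 ((W.baseChange (v.adicCompletion ℚ)).localTamagawaNumber
        (v.adicCompletionIntegers ℚ)) +
      padicValNat 3 (((W.quadraticTwist (d : ℚ)).baseChange (v.adicCompletion ℚ)).localTamagawaNumber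
        (v.adicCompletionIntegers ℚ)) = 1 := by
  haveI : (W.baseChange (v.adicCompletion ℚ)).IsElliptic := by rw [baseChange]; infer_instance
  haveI : Finite (ResidueField (v.adicCompletionIntegers ℚ)) :=
    finite_residueField_adicCompletionIntegers_rat v
  haveI : PerfectField (ResidueField (v.adicCompletionIntegers ℚ)) := PerfectField.ofFinite
  obtain ⟨d', hd'⟩ : ∃ d' : (v.adicCompletionIntegers ℚ)ˣ, (d' : v.adicCompletionIntegers ℚ) = d :=
    ⟨(isUnit_adicCompletionIntegers_intCast v hd).unit, IsUnit.unit_spec _⟩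
  have hns' : ¬ IsSquare (residue (v.adicCompletionIntegers ℚ) (d' : v.adicCompletionIntegers ℚ)) := by
    rw [hd', isSquare_residue_intCast_iff]; exact hns
  obtain ⟨J, D, γ, ε, hJ, hmin, h1, h2, hγ, h4, hε, hdisc⟩ :=
    exists_normalForm_IVstar_of_kodairaSymbolAt_eq_IVstar v W hIV
  haveI := hmin
  rw [baseChange_quadraticTwist_eq W v d' hd']
  exact padicValNat_localTamagawaNumber_add_quadraticTwist_of_normalForm_IVstar
    (isUnit_two_adicCompletionIntegers v hv2) (W.baseChange (v.adicCompletion ℚ)) J D hJ h1 h2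
    irreducible_uniformizer hγ h4 hε hdisc d' hns'

end RatPlace

end TypeIVTwist

end Summit.BirchSwinnertonDyer.Rank1Residual.AdditivePotMult

end
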